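import Summits.QuantumFields.YangMills.Theorems.BalabanUVNodesN15SiteScalarLayerMassless
import Summits.QuantumFields.YangMills.Theorems.BalabanUVNodesN15KingModelFullPropagatorByPartsNE2
import HarnessLib

/-!
# Route «BalabanUVNodes», cluster K4 «SpineRates» — node N15 = NE2: THE SITE LAYER WITH THE BACKGROUND LIVE IN THE TwoGrid ENTRY CURRENCY, VIII — THE DERIVED PIECES
# `D_μ = N∇_μG′` OF THE MASSLESS SCALAR SITE PROPAGATOR AT `m² = 0`, and THE SIX-LETTER `U ≡ 1` PACKAGE (`G, D_μ`: size on both grids + two-grid defects) that dag-n15-c S4's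
# dressing `dressedOp G D V̂` and this seat's part V socket consume — ONE `(β, δ, m₀)`

Cell `pub-ymgap`, WIDTH SEAT `pub-ymgap-dag-n15-w1` (generation 2; director-ym №197 ∕ HUMAN RULING D-0149; chair R455 (A) ∕ R461; plan g81 `W-SEAT-START-LIST.md` v8 §n15).  `bears_on:
R4∕N15 · K3⁷ SpineGivenEndpointR13SepCoPH (stmt-QuantumFields-20544)`.  Filed `--kind proof --supports stmt-QuantumFields-20544 --as helper` — COUNT-NEUTRAL.  THEOREMS ONLY (0 `def`,
0 `sorry`).  Imports this seat's part VII `…N15SiteScalarLayerMassless` (`hasMaj_ofBlocks_of_massLimit`, `continuousAt_fineOp_inv_mulVec_mass`, `continuousAt_kingGOp_mass`,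
`kingGOp_massless_letters`) and dag-n15-e Σ-d `…N15KingModelFullPropagatorByPartsNE2` (`hasMaj_kingDOp_coarse`; through it Σ-a `kingFullProp_uniform_layer`) BY NAME; nothing in the tree is
modified.

WHY.  dag-n15-c S4 `SiteLayer.hasMaj_dressedOp` ∕ `hasMaj_dressedOp_sub` ∕ `hasMaj_idef_dressedOp` build the DRESSED scalar propagator `G′(U′U) = pr_none (1 − ĜV̂)⁻¹Ĝ` and its three
letters from the `U ≡ 1` layer `G` TOGETHER WITH its derived pieces `D_μ` (the first-order perturbation `V̂` reads `(Gλ, D_μλ)`): hypotheses `hG, hD, hG′, hD′, hDG, hDD` — the SAME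
`β, δ, m₀θ` for `G` and every `D_μ`, on both grids.  Part VII supplied the `G` half at `m² = 0`; THIS FILE supplies the `D_μ = N∇_μ∘A₀⁻¹ = kingDOp L a 0 K N M μ` half the same way
(dag-n15-e's mass-uniform letters — Σ-d `hasMaj_kingDOp_coarse`, Σ-a conjuncts 4 and 7 — passed to `m² = 0` by part VII §1 and the continuity of `D_μ` in the mass) and PACKAGES the
six letters at one `(β, δ, m₀)`.

CONTENTS ([folklore] bookkeeping + three landed theorems BY NAME).
* §1 `continuousAt_kingDOp_mass`, `continuousAt_idef_kingDOp_mass` (`D_μλ x = N·((Gλ)(x + e_μ) − (Gλ)(x))`, part VII §2).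
* §2 ★ `kingDOp_massless_letters`: `D_μ ≤ β·e^{−δd}` (coarse, `blockOf`), `D′_μ ≤ β·e^{−δd}` (fine, `blockOf ∘ underPtN`), `𝔇(D′_μ, D_μ) ≤ m₀·(L^K)^{−γ∕2}·e^{−δd}` at `m² = 0`, every `μ`.
* §3 ★★ **`kingScalarLayer_massless_letters`**: the SIX letters (`G` ×3 of part VII + `D_μ` ×3 of §2) at ONE `(β, δ, m₀)` — verbatim the `U ≡ 1` input (`hG, hD, hG′, hD′, hDG, hDD`) of
  S4's three dressing theorems on the sized carrier `unitTorusGeoS L K M Msz`, King's blocks and pairing, for the GENUINE massless scalar site propagator of the tori of record.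

HONEST FRAMING.  Count-neutral helper; NO new estimate (closedness + continuity + `max`∕`min` of constants over landed theorems); `U ≡ 1` linear theory on the finite tori of record
`M_μ = 2L^e` with King's running couplings; the species `V̂(U)` (the scalar-site background perturbation built from a lane family's configurations) and the knit to `NE2PlusSite` are
NOT here (next file).  NOT [B9] Thm 3.2 at a general (3.35)-regular `U` (NE2⁺ NOT PRINTED as an η-rate); Node 00's [B9] layers of record are residual — **N15 is NOT discharged** (typed
28∕28 · discharged 5∕27 of record unchanged); one finite four-torus programme at fixed `ε` — NOT ℝ⁴, NOT infinite volume, NOT OS, NOT a mass gap, NOT Clay; R4 closes the conditional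
finite-𝕋⁴ rung `BalabanLadder.UV` only.  Restate-immune (no Theses import).
-/

set_option autoImplicit false

noncomputable section

open scoped BigOperators Matrix Topology
open Finset Filter

namespace Summit.QuantumFields.YangMills.BalabanUVNodes.N15.SiteLayerBg

open Literature.MathematicalPhysics.QuantumFieldTheory.Balaban1983to89
open Literature.MathematicalPhysics.QuantumFieldTheory.Balaban1983to89.B11SectG (BlockNorm HasMaj)
open Literature.MathematicalPhysics.QuantumFieldTheory.Balaban1983to89.T4EtaRateDefect (idef idef_apply)
open Literature.MathematicalPhysics.QuantumFieldTheory.Balaban1983to89.T4EtaRateCoeffDefect (pull pull_apply)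
open Literature.MathematicalPhysics.QuantumFieldTheory.Balaban1983to89.B5Prop11Plancherel (Tor fine unitVec)
open Literature.MathematicalPhysics.QuantumFieldTheory.King1986 (aK aK_pos)
open Literature.MathematicalPhysics.QuantumFieldTheory.King1986.Torus (fineOp blockOf tdistT tdistT_nonneg)
open Summit.QuantumFields.YangMills.BalabanUVNodes.N15.VectorPiece (unitTorusGeoS)
open Summit.QuantumFields.YangMills.BalabanUVNodes.N15KingModelRung.Curved (kingGOp kingGOp_apply kingDOp kingDOp_apply underPtN kingFullProp_uniform_layer hasMaj_kingDOp_coarse)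

variable {d : ℕ}

/-! ## §1 Continuity in the mass of the derived pieces `D_μ = N∇_μ∘A₀⁻¹` and of their two-grid defect -/

section Continuity

variable (M : Fin (d + 1) → ℕ) [∀ μ, NeZero (M μ)] (N : ℕ) [NeZero N] (L : ℕ)

/-- `m² ↦ (D_μλ)(x) = N·((A₀(a_K, N², m²)⁻¹λ)(x + e_μ) − (A₀(a_K, N², m²)⁻¹λ)(x))` is continuous at `m² = 0` (`K ≥ 1`, `a > 0`, `L > 1`). [cite: King1986, (4.1)–(4.5) p.670; Balaban1985BackgroundPropagators, (3.42) p.397 (second entry, shape)] -/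
theorem continuousAt_kingDOp_mass (hL : 1 < L) {a : ℝ} (ha : 0 < a) {K : ℕ} (hK : 1 ≤ K) (μ : Fin (d + 1)) (lam : Tor (fine N M) → ℝ) (x : Tor (fine N M)) :
    ContinuousAt (fun m2 : ℝ => kingDOp L a m2 K N M μ lam x) 0 := by
  have hLr : (1 : ℝ) < (L : ℝ) := by exact_mod_cast hL
  simp only [kingDOp_apply]
  exact continuousAt_const.mul ((continuousAt_fineOp_inv_mulVec_mass M N (aK_pos ha hLr hK) lam _).sub
    (continuousAt_fineOp_inv_mulVec_mass M N (aK_pos ha hLr hK) lam x))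

/-- `m² ↦ (𝔇^π(D′_μ, D_μ)λ)(x′) = (D′_μ(λ∘π))(x′) − (D_μλ)(πx′)` for the two runs is continuous at `m² = 0`. [cite: King1986, p.664 (pairing), (4.1)–(4.5) p.670] -/
theorem continuousAt_idef_kingDOp_mass [NeZero L] (hL : 1 < L) {a : ℝ} (ha : 0 < a) {K : ℕ} (hK : 1 ≤ K) (n : ℕ) (μ : Fin (d + 1)) (lam : Tor (fine (L ^ K) M) → ℝ)
    (x' : Tor (fine (L ^ n * L ^ K) M)) :
    ContinuousAt (fun m2 : ℝ => idef (pull (underPtN L K n M)) (pull (underPtN L K n M)) (kingDOp L a m2 (K + n) (L ^ n * L ^ K) M μ)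
      (kingDOp L a m2 K (L ^ K) M μ) lam x') 0 := by
  simp only [idef_apply, Pi.sub_apply, pull_apply]
  exact (continuousAt_kingDOp_mass M (L ^ n * L ^ K) L hL ha (hK.trans (Nat.le_add_right K n)) μ _ x').sub
    (continuousAt_kingDOp_mass M (L ^ K) L hL ha hK μ lam _)

end Continuity

/-! ## §2 ★ The derived pieces at `m² = 0`: size on both grids and the two-grid defect, uniformly -/

section Derived

variable (L : ℕ) [NeZero L]

/-- ★ **THE DERIVED PIECES `D_μ = N∇_μG′` OF THE MASSLESS SCALAR SITE PROPAGATOR AS BLOCK LETTERS.**  For odd `L ≥ 3`, `a > 0`, `0 ≤ γ < 1` there are `β, δ, m₀ > 0` such that for every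
`K ≥ 1`, `n ≥ 1`, cube `M_μ = 2L^e`, size datum `Msz` and direction `μ`: `D_μ = kingDOp L a 0 K (L^K) M μ ≤ β·e^{−δ|y−y′|_T}` (coarse, blocks `blockOf`), `D′_μ = kingDOp L a 0 (K+n) (L^nL^K) M μ ≤
β·e^{−δ|y−y′|_T}` (fine, blocks `blockOf ∘ underPtN`), `𝔇(D′_μ, D_μ) ≤ m₀·(L^K)^{−γ∕2}·e^{−δ|y−y′|_T}` — dag-n15-e Σ-d `hasMaj_kingDOp_coarse` and Σ-a `kingFullProp_uniform_layer` (conjuncts 4, 7) on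
`(0, 1]` passed to `m² = 0` by part VII §1 and §1. [cite: Balaban1985BackgroundPropagators, Thm 3.1 (3.42) p.397 (second entry, shape); King1986, Thm 3.3 (3.7) p.656, Prop. 3.8 (3.71) p.664, p.664 (pairing); Balaban1983RegularityDecay, Theorem (1.10) p.573] -/
theorem kingDOp_massless_letters (hLodd : Odd L) (hL : 2 ≤ L) {a : ℝ} (ha : 0 < a) {γ : ℝ} (hγ0 : 0 ≤ γ) (hγ1 : γ < 1) :
    ∃ β δ m₀ : ℝ, 0 < β ∧ 0 < δ ∧ 0 < m₀ ∧ ∀ (K : ℕ), 1 ≤ K → ∀ (n : ℕ), 1 ≤ n → ∀ (e : ℕ) (M : Fin (d + 1) → ℕ) [∀ μ, NeZero (M μ)],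
      (∀ μ, M μ = 2 * L ^ e) → ∀ (Msz : ℝ) (μ : Fin (d + 1)),
      HasMaj (BlockNorm.ofBlocks (unitTorusGeoS L K M Msz) (blockOf (L ^ K) M)) (BlockNorm.ofBlocks (unitTorusGeoS L K M Msz) (blockOf (L ^ K) M))
          (kingDOp L a 0 K (L ^ K) M μ) (fun y y' => β * Real.exp (-(δ * tdistT M y y')))
      ∧ HasMaj (BlockNorm.ofBlocks (unitTorusGeoS L K M Msz) (blockOf (L ^ K) M ∘ underPtN L K n M))
          (BlockNorm.ofBlocks (unitTorusGeoS L K M Msz) (blockOf (L ^ K) M ∘ underPtN L K n M))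
          (kingDOp L a 0 (K + n) (L ^ n * L ^ K) M μ) (fun y y' => β * Real.exp (-(δ * tdistT M y y')))
      ∧ HasMaj (BlockNorm.ofBlocks (unitTorusGeoS L K M Msz) (blockOf (L ^ K) M))
          (BlockNorm.ofBlocks (unitTorusGeoS L K M Msz) (blockOf (L ^ K) M ∘ underPtN L K n M))
          (idef (pull (underPtN L K n M)) (pull (underPtN L K n M)) (kingDOp L a 0 (K + n) (L ^ n * L ^ K) M μ) (kingDOp L a 0 K (L ^ K) M μ))
          (fun y y' => m₀ * ((L : ℝ) ^ K) ^ (-(γ / 2)) * Real.exp (-(δ * tdistT M y y'))) := by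
  obtain ⟨βc, δc, hβc, hδc, Hc⟩ := hasMaj_kingDOp_coarse (d := d) L hLodd hL ha (zero_le_one : (0 : ℝ) ≤ 1)
  obtain ⟨βa, δa, m₀, hβa, hδa, hm₀, Ha⟩ := kingFullProp_uniform_layer (d := d) L hLodd hL ha (zero_le_one : (0 : ℝ) ≤ 1) hγ0 hγ1
  have hL1 : 1 < L := hL
  set β : ℝ := max βc βa with hβ
  set δ : ℝ := min δc δa with hδ
  have hβpos : 0 < β := lt_max_of_lt_left hβc
  have hδpos : 0 < δ := lt_min hδc hδa
  refine ⟨β, δ, m₀, hβpos, hδpos, hm₀, fun K hK n hn e M _ hM Msz μ => ⟨?_, ?_, ?_⟩⟩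
  · -- coarse size at `m² = 0`
    have key := hasMaj_ofBlocks_of_massLimit (g := unitTorusGeoS L K M Msz) (blockOf (L ^ K) M) (blockOf (L ^ K) M)
      (fun m2 : ℝ => kingDOp L a m2 K (L ^ K) M μ) (fun y y' => βc * Real.exp (-(δc * tdistT M y y'))) one_pos
      (fun lam x => continuousAt_kingDOp_mass M (L ^ K) L hL1 ha hK μ lam x) fun m hm hm1 => Hc K hK e M hM m hm hm1 Msz μ
    exact key.mono fun y y' => mul_le_mul (le_max_left _ _)
      (Real.exp_le_exp.mpr (neg_le_neg (mul_le_mul_of_nonneg_right (min_le_left _ _) (tdistT_nonneg M y y')))) (Real.exp_nonneg _) hβpos.le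
  · -- fine size at `m² = 0` (Σ-a conjunct 4)
    have key := hasMaj_ofBlocks_of_massLimit (g := unitTorusGeoS L K M Msz) (blockOf (L ^ K) M ∘ underPtN L K n M) (blockOf (L ^ K) M ∘ underPtN L K n M)
      (fun m2 : ℝ => kingDOp L a m2 (K + n) (L ^ n * L ^ K) M μ) (fun y y' => βa * Real.exp (-(δa * tdistT M y y'))) one_pos
      (fun lam x => continuousAt_kingDOp_mass M (L ^ n * L ^ K) L hL1 ha (hK.trans (Nat.le_add_right K n)) μ lam x)
      fun m hm hm1 => (Ha K hK n hn e M hM m hm hm1 Msz μ).2.2.2.1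
    exact key.mono fun y y' => mul_le_mul (le_max_right _ _)
      (Real.exp_le_exp.mpr (neg_le_neg (mul_le_mul_of_nonneg_right (min_le_right _ _) (tdistT_nonneg M y y')))) (Real.exp_nonneg _) hβpos.le
  · -- two-grid defect at `m² = 0` (Σ-a conjunct 7)
    have hθ : 0 ≤ m₀ * ((L : ℝ) ^ K) ^ (-(γ / 2)) := mul_nonneg hm₀.le (Real.rpow_nonneg (pow_nonneg (Nat.cast_nonneg _) _) _)
    have key := hasMaj_ofBlocks_of_massLimit (g := unitTorusGeoS L K M Msz) (blockOf (L ^ K) M) (blockOf (L ^ K) M ∘ underPtN L K n M)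
      (fun m2 : ℝ => idef (pull (underPtN L K n M)) (pull (underPtN L K n M)) (kingDOp L a m2 (K + n) (L ^ n * L ^ K) M μ) (kingDOp L a m2 K (L ^ K) M μ))
      (fun y y' => m₀ * ((L : ℝ) ^ K) ^ (-(γ / 2)) * Real.exp (-(δa * tdistT M y y'))) one_pos
      (fun lam x => continuousAt_idef_kingDOp_mass M L hL1 ha hK n μ lam x) fun m hm hm1 => (Ha K hK n hn e M hM m hm hm1 Msz μ).2.2.2.2.2.2.1
    exact key.mono fun y y' => mul_le_mul_of_nonneg_left
      (Real.exp_le_exp.mpr (neg_le_neg (mul_le_mul_of_nonneg_right (min_le_right _ _) (tdistT_nonneg M y y')))) hθ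

end Derived

/-! ## §3 ★★ The six-letter `U ≡ 1` package of the massless scalar site layer at ONE `(β, δ, m₀)` -/

section Package

variable (L : ℕ) [NeZero L]

/-- ★★ **THE `U ≡ 1` INPUT OF THE DRESSING, FOR THE GENUINE MASSLESS SCALAR SITE PROPAGATOR.**  For odd `L ≥ 3`, `a > 0`, `0 ≤ γ < 1` there are `β, δ, m₀ > 0` such that for every
`K ≥ 1`, `n ≥ 1`, cube `M_μ = 2L^e` and size datum `Msz`, with `G = kingGOp L a 0 K (L^K) M`, `G′ = kingGOp L a 0 (K+n) (L^nL^K) M`, `D_μ = kingDOp L a 0 K (L^K) M μ`, `D′_μ = kingDOp L a 0 (K+n)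
(L^nL^K) M μ`, blocks `blockOf (L^K) M` (coarse) ∕ `blockOf (L^K) M ∘ underPtN L K n M` (fine), transports `pull underPtN`: `G, D_μ ≤ β·e^{−δ|y−y′|_T}` (coarse), `G′, D′_μ ≤ β·e^{−δ|y−y′|_T}`
(fine), `𝔇(G′, G), 𝔇(D′_μ, D_μ) ≤ m₀·(L^K)^{−γ∕2}·e^{−δ|y−y′|_T}` — verbatim the hypotheses `hG, hD, hG′, hD′, hDG, hDD` of dag-n15-c S4 `hasMaj_dressedOp` ∕ `hasMaj_dressedOp_sub` ∕
`hasMaj_idef_dressedOp` (with `θ = (L^K)^{−γ∕2}`) on the carrier `unitTorusGeoS L K M Msz`, and the first three conjuncts of part V's `hL`. [cite: Balaban1985BackgroundPropagators, Thm 3.1 (3.42) p.397 (first two entries, shape), (3.63)–(3.65) pp.402–403 (mechanism); King1986, Thm 3.3 (3.7) p.656, Prop. 3.8 (3.71) p.664; Balaban1983RegularityDecay, Theorem (1.10) p.573; Balaban1984PropagatorsI, Prop. 1.2 (1.110) p.35 (shape)] -/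
theorem kingScalarLayer_massless_letters (hLodd : Odd L) (hL : 2 ≤ L) {a : ℝ} (ha : 0 < a) {γ : ℝ} (hγ0 : 0 ≤ γ) (hγ1 : γ < 1) :
    ∃ β δ m₀ : ℝ, 0 < β ∧ 0 < δ ∧ 0 < m₀ ∧ ∀ (K : ℕ), 1 ≤ K → ∀ (n : ℕ), 1 ≤ n → ∀ (e : ℕ) (M : Fin (d + 1) → ℕ) [∀ μ, NeZero (M μ)],
      (∀ μ, M μ = 2 * L ^ e) → ∀ (Msz : ℝ),
      HasMaj (BlockNorm.ofBlocks (unitTorusGeoS L K M Msz) (blockOf (L ^ K) M)) (BlockNorm.ofBlocks (unitTorusGeoS L K M Msz) (blockOf (L ^ K) M))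
          (kingGOp L a 0 K (L ^ K) M) (fun y y' => β * Real.exp (-(δ * tdistT M y y')))
      ∧ (∀ μ, HasMaj (BlockNorm.ofBlocks (unitTorusGeoS L K M Msz) (blockOf (L ^ K) M)) (BlockNorm.ofBlocks (unitTorusGeoS L K M Msz) (blockOf (L ^ K) M))
          (kingDOp L a 0 K (L ^ K) M μ) (fun y y' => β * Real.exp (-(δ * tdistT M y y'))))
      ∧ HasMaj (BlockNorm.ofBlocks (unitTorusGeoS L K M Msz) (blockOf (L ^ K) M ∘ underPtN L K n M))
          (BlockNorm.ofBlocks (unitTorusGeoS L K M Msz) (blockOf (L ^ K) M ∘ underPtN L K n M))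
          (kingGOp L a 0 (K + n) (L ^ n * L ^ K) M) (fun y y' => β * Real.exp (-(δ * tdistT M y y')))
      ∧ (∀ μ, HasMaj (BlockNorm.ofBlocks (unitTorusGeoS L K M Msz) (blockOf (L ^ K) M ∘ underPtN L K n M))
          (BlockNorm.ofBlocks (unitTorusGeoS L K M Msz) (blockOf (L ^ K) M ∘ underPtN L K n M))
          (kingDOp L a 0 (K + n) (L ^ n * L ^ K) M μ) (fun y y' => β * Real.exp (-(δ * tdistT M y y'))))
      ∧ HasMaj (BlockNorm.ofBlocks (unitTorusGeoS L K M Msz) (blockOf (L ^ K) M))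
          (BlockNorm.ofBlocks (unitTorusGeoS L K M Msz) (blockOf (L ^ K) M ∘ underPtN L K n M))
          (idef (pull (underPtN L K n M)) (pull (underPtN L K n M)) (kingGOp L a 0 (K + n) (L ^ n * L ^ K) M) (kingGOp L a 0 K (L ^ K) M))
          (fun y y' => m₀ * ((L : ℝ) ^ K) ^ (-(γ / 2)) * Real.exp (-(δ * tdistT M y y')))
      ∧ (∀ μ, HasMaj (BlockNorm.ofBlocks (unitTorusGeoS L K M Msz) (blockOf (L ^ K) M))
          (BlockNorm.ofBlocks (unitTorusGeoS L K M Msz) (blockOf (L ^ K) M ∘ underPtN L K n M))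
          (idef (pull (underPtN L K n M)) (pull (underPtN L K n M)) (kingDOp L a 0 (K + n) (L ^ n * L ^ K) M μ) (kingDOp L a 0 K (L ^ K) M μ))
          (fun y y' => m₀ * ((L : ℝ) ^ K) ^ (-(γ / 2)) * Real.exp (-(δ * tdistT M y y')))) := by
  obtain ⟨β₁, δ₁, m₁, hβ₁, hδ₁, hm₁, H1⟩ := kingGOp_massless_letters (d := d) L hLodd hL ha hγ0 hγ1
  obtain ⟨β₂, δ₂, m₂, hβ₂, hδ₂, hm₂, H2⟩ := kingDOp_massless_letters (d := d) L hLodd hL ha hγ0 hγ1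
  set β : ℝ := max β₁ β₂ with hβ
  set δ : ℝ := min δ₁ δ₂ with hδ
  set m₀ : ℝ := max m₁ m₂ with hm₀
  have hβpos : 0 < β := lt_max_of_lt_left hβ₁
  have hδpos : 0 < δ := lt_min hδ₁ hδ₂
  have hm₀pos : 0 < m₀ := lt_max_of_lt_left hm₁
  -- weakening a size letter `C·e^{−ρd} ≤ β·e^{−δd}` and a defect letter `m·θ·e^{−ρd} ≤ m₀·θ·e^{−δd}`
  have wk : ∀ {C ρ : ℝ} (M : Fin (d + 1) → ℕ) [∀ μ, NeZero (M μ)], C ≤ β → δ ≤ ρ → ∀ y y' : Tor M,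
      C * Real.exp (-(ρ * tdistT M y y')) ≤ β * Real.exp (-(δ * tdistT M y y')) := fun M _ hC hρ y y' =>
    mul_le_mul hC (Real.exp_le_exp.mpr (neg_le_neg (mul_le_mul_of_nonneg_right hρ (tdistT_nonneg M y y')))) (Real.exp_nonneg _) hβpos.le
  have wkd : ∀ {m ρ : ℝ} (M : Fin (d + 1) → ℕ) [∀ μ, NeZero (M μ)] (K : ℕ), 0 ≤ m → m ≤ m₀ → δ ≤ ρ → ∀ y y' : Tor M,
      m * ((L : ℝ) ^ K) ^ (-(γ / 2)) * Real.exp (-(ρ * tdistT M y y')) ≤ m₀ * ((L : ℝ) ^ K) ^ (-(γ / 2)) * Real.exp (-(δ * tdistT M y y')) :=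
    fun M _ K hm hmm hρ y y' => by
      have hθ : 0 ≤ ((L : ℝ) ^ K) ^ (-(γ / 2)) := Real.rpow_nonneg (pow_nonneg (Nat.cast_nonneg _) _) _
      exact mul_le_mul (mul_le_mul_of_nonneg_right hmm hθ)
        (Real.exp_le_exp.mpr (neg_le_neg (mul_le_mul_of_nonneg_right hρ (tdistT_nonneg M y y')))) (Real.exp_nonneg _) (mul_nonneg hm₀pos.le hθ)
  refine ⟨β, δ, m₀, hβpos, hδpos, hm₀pos, fun K hK n hn e M _ hM Msz => ?_⟩
  obtain ⟨g1, g2, g3⟩ := H1 K hK n hn e M hM Msz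
  refine ⟨g1.mono (wk M (le_max_left _ _) (min_le_left _ _)), fun μ => ?_, g2.mono (wk M (le_max_left _ _) (min_le_left _ _)), fun μ => ?_,
    g3.mono (wkd M K hm₁.le (le_max_left _ _) (min_le_left _ _)), fun μ => ?_⟩
  · exact (H2 K hK n hn e M hM Msz μ).1.mono (wk M (le_max_right _ _) (min_le_right _ _))
  · exact (H2 K hK n hn e M hM Msz μ).2.1.mono (wk M (le_max_right _ _) (min_le_right _ _))
  · exact (H2 K hK n hn e M hM Msz μ).2.2.mono (wkd M K hm₂.le (le_max_right _ _) (min_le_right _ _))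

end Package

end Summit.QuantumFields.YangMills.BalabanUVNodes.N15.SiteLayerBg

end
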